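import Summits.QuantumAdvantage.QuantumAdvantage.Theorems.SosSandwichQueryTopLevelWeight
import Summits.QuantumAdvantage.QuantumAdvantage.Theorems.SosSandwichTopHomogeneousFourier
import Summits.QuantumAdvantage.QuantumAdvantage.Theorems.SosSandwichOneQueryFrameAAFourier
import HarnessLib

/-!
# The HOMOGENEOUS RUNG HOLDS ON `Q_T` (Escudero Gutiérrez, Cor. 1.7) — kernel form in the tree's `QQueryAlg` model

Support theorem for route `SosSandwich`, crux `PseudoBoundedAA` (stmt-QuantumAdvantage-15237); Part 3 of the
package `SosSandwichQueryTopLevelStep` / `SosSandwichQueryTopLevelWeight` / this file.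

CONTEXT.  The route's degree-free homogeneous rung `HomogeneousPBAA` ("`p ∈ K_T` top-homogeneous ⟹
`maxInf ≥ C·Var²`") was REFUTED on the SOS sandwich class `K_T` (`Theorems.SosSandwich.not_HomogeneousPBAA`: the
self-composed address family, `Inf = 16 Var²/T`), and the route file's kill criteria say: "if [the witness] lies
in `K_T ∖ Q_T`, pivot once to [the genuine-algorithm class]".  This file proves that on `Q_T` — acceptance
probabilities of `T`-query quantum algorithms in the tree's model `Literature.Computability.Cryptography.QQueryAlg`
— the degree-free rung is TRUE with the explicit constant `4` (tree influence `= 4 ×` O'Donnell influence):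

* `cubeFourierCoeff_acceptProb_eq_topCoeff` — for `|U| = 2T` the Walsh coefficient of the acceptance probability is
  the top-level bilinear coefficient `B(U) = Σ_{R ⊆ U, |R| = T} ⟨Π v_R, Π v_{U∖R}⟩` of Part 2 (Fourier inversion for
  the vector coefficients, `χ_S χ_{S'} χ_U`-orthogonality, and Beals et al.'s level bound `v_S = 0` for `|S| > T`);
* `topWeight_sq_le_influence` — for EVERY `T`-query algorithm: `∃ i, Inf_i[p] ≥ 4·(Σ_{|U|=2T} p̂(U)²)²`
  (no homogeneity; E-G's inequality for the top level);
* **`queryHomogeneousRung`** — if the acceptance polynomial `p` is top-homogeneous of order `T` (the Laplacian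
  eigen-equation `Σᵢ (p(x) − p(x ⊕ eᵢ)) = 4T·(p(x) − E p)`, verbatim the antecedent of the route's
  `HomogeneousPBAA(T)`), then `∃ i, 4·Var[p]² ≤ Inf_i[p]` — Escudero Gutiérrez's Corollary 1.7
  (`maxInf ≥ Var²` in O'Donnell's normalisation), degree-free.

So the exact split of the crux recorded in `SosSandwichPseudoBoundedAARepairedLine`
(`PB-AA ⟺ HomogeneousPBAAT ∧ LevelDescent`) has its homogeneous half settled WITHOUT `T`-loss on the sub-class
`Q_T ⊊ K_T`; the `T`-loss of `HomogeneousPBAAT` (stmt-27399, `c ≥ 2` forced on `K_T`) is a phenomenon of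
`K_T ∖ Q_T` only.  Proof = coefficient-space form of E-G's creation-operator argument (Parts 1–2), no completely
bounded norms.  Vocabulary: `boolVariance` / `influence` / `evalBool` / `boolAvg` (definitionally the route file's
inline `let ev … let avg …`).  All proved, standard axioms.

Sources: EscuderoGutierrez2023 (arXiv:2304.06713) Thm 1.6, Cor 1.7, §4.2; BealsEtAl2001 (arXiv:quant-ph/9802049)
Lemma 4.1/4.2; ODonnell2014 §1.4, §2.2.
-/

noncomputable section

set_option linter.dupNamespace false

namespace Summit.QuantumAdvantage.QuantumAdvantage.Theorems.SosSandwich.QueryTopLevel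

open Matrix Finset Literature.Computability.Cryptography Literature.Computability.QuantumComplexity
open Literature.Computability.Complexity.LowDegree Literature.Probability.RandomGraphs.LowDegree
open Summit.QuantumAdvantage.QuantumAdvantage.Theorems.SosSandwich.QueryFourier

variable {N : ℕ} {W : Type*} [Fintype W]

/-! ## `B(U) = p̂(U)` and the homogeneous rung on `Q_T` -/

section Rung

open scoped symmDiff

omit [Fintype W] in
/-- **Fourier inversion for the vector coefficients**: `ψ_x = Σ_S v_S χ_S(x)`. [cite: ODonnell2014, Thm 1.1] -/
theorem sum_vfc_mul_walsh (ψ : (Fin N → Bool) → Fin N × Bool × W → ℂ) (x : Fin N → Bool) (s : Fin N × Bool × W) :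
    ∑ S : Finset (Fin N), vfc ψ S s * (walsh S x : ℂ) = ψ x s := by
  have h2 : (2 : ℂ) ^ N ≠ 0 := pow_ne_zero _ two_ne_zero
  simp only [vfc]
  have e : ∀ S : Finset (Fin N), (∑ y, ψ y s * (walsh S y : ℂ)) / 2 ^ N * (walsh S x : ℂ) =
      (∑ y, ψ y s * ((walsh S y : ℂ) * (walsh S x : ℂ))) / 2 ^ N := by
    intro S
    rw [div_mul_eq_mul_div, Finset.sum_mul]
    congr 1
    exact Finset.sum_congr rfl fun y _ => by ring
  simp_rw [e]
  rw [← Finset.sum_div, Finset.sum_comm]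
  have inner : ∀ y : Fin N → Bool, ∑ S : Finset (Fin N), ψ y s * ((walsh S y : ℂ) * (walsh S x : ℂ)) =
      if y = x then ψ y s * 2 ^ N else 0 := by
    intro y
    rw [← Finset.mul_sum]
    have hw : ∑ S : Finset (Fin N), (walsh S y : ℂ) * (walsh S x : ℂ) =
        ((∑ S : Finset (Fin N), walsh S y * walsh S x : ℝ) : ℂ) := by push_cast; rfl
    rw [hw, sum_walsh_mul_walsh, Fintype.card_fin]
    split_ifs <;> simp
  simp_rw [inner]
  rw [Finset.sum_ite_eq' Finset.univ x]
  simp only [Finset.mem_univ, if_true]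
  field_simp

omit [Fintype W] in
/-- `2^{-N} Σ_x χ_S(x) χ_{S'}(x) χ_U(x) = [S ∆ S' = U]`. [cite: ODonnell2014, §1.4] -/
theorem sum_walsh_three (S S' U : Finset (Fin N)) :
    ∑ x : Fin N → Bool, (walsh S x : ℂ) * (walsh S' x : ℂ) * (walsh U x : ℂ) =
      if S ∆ S' = U then (2 : ℂ) ^ N else 0 := by
  have e : ∀ x : Fin N → Bool, (walsh S x : ℂ) * (walsh S' x : ℂ) * (walsh U x : ℂ) =
      ((walsh (S ∆ S') x * walsh U x : ℝ) : ℂ) := by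
    intro x
    rw [← walsh_mul_walsh]; push_cast; ring
  simp_rw [e]
  rw [show (∑ x : Fin N → Bool, ((walsh (S ∆ S') x * walsh U x : ℝ) : ℂ)) =
      ((∑ x : Fin N → Bool, walsh (S ∆ S') x * walsh U x : ℝ) : ℂ) by push_cast; rfl,
    sum_walsh_mul_walsh_index]
  split_ifs <;> simp

/-- **Walsh coefficient of a squared norm**: for `φ : x ↦ φ_x ∈ ℂ^β` with coefficients `v_S`,
`2^{-N} Σ_x ‖φ_x‖² χ_U(x) = Σ_S ⟨v_S, v_{S ∆ U}⟩`. [cite: ODonnell2014, §1.4] -/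
theorem fourierCoeff_norm_sq (φ : (Fin N → Bool) → Fin N × Bool × W → ℂ) (U : Finset (Fin N)) :
    ((∑ x : Fin N → Bool, (∑ s, ‖φ x s‖ ^ 2) * walsh U x) / 2 ^ N : ℝ) =
      (∑ S : Finset (Fin N), star (vfc φ S) ⬝ᵥ vfc φ (S ∆ U)).re := by
  -- work in `ℂ`
  have h2 : (2 : ℂ) ^ N ≠ 0 := pow_ne_zero _ two_ne_zero
  have key : (((∑ x : Fin N → Bool, (∑ s, ‖φ x s‖ ^ 2) * walsh U x) / 2 ^ N : ℝ) : ℂ) =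
      ∑ S : Finset (Fin N), star (vfc φ S) ⬝ᵥ vfc φ (S ∆ U) := by
    -- expand `‖φ_x(s)‖² = conj(φ_x s) φ_x s` and both factors in the Walsh basis
    have e1 : ∀ x : Fin N → Bool, (((∑ s, ‖φ x s‖ ^ 2) * walsh U x : ℝ) : ℂ) =
        ∑ s, (∑ S : Finset (Fin N), star (vfc φ S s) * (walsh S x : ℂ)) *
          (∑ S' : Finset (Fin N), vfc φ S' s * (walsh S' x : ℂ)) * (walsh U x : ℂ) := by
      intro x
      push_cast
      rw [Finset.sum_mul]
      refine Finset.sum_congr rfl fun s _ => ?_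
      rw [sum_vfc_mul_walsh]
      have hstar : ∑ S : Finset (Fin N), star (vfc φ S s) * (walsh S x : ℂ) = star (φ x s) := by
        rw [← sum_vfc_mul_walsh φ x s, star_sum]
        refine Finset.sum_congr rfl fun S _ => ?_
        rw [star_mul, Complex.star_def, Complex.conj_ofReal, mul_comm]
      rw [hstar, Complex.star_def, Complex.conj_mul']
    push_cast
    rw [Finset.sum_div]
    simp_rw [show ∀ x : Fin N → Bool, ((∑ s, (‖φ x s‖ : ℂ) ^ 2) * (walsh U x : ℂ)) =
        (((∑ s, ‖φ x s‖ ^ 2) * walsh U x : ℝ) : ℂ) from fun x => by push_cast; ring, e1]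
    -- now a finite rearrangement
    simp only [dotProduct, Pi.star_apply]
    calc ∑ x : Fin N → Bool, (∑ s, (∑ S : Finset (Fin N), star (vfc φ S s) * (walsh S x : ℂ)) *
            (∑ S' : Finset (Fin N), vfc φ S' s * (walsh S' x : ℂ)) * (walsh U x : ℂ)) / 2 ^ N
        = ∑ x : Fin N → Bool, ∑ s, ∑ S : Finset (Fin N), ∑ S' : Finset (Fin N),
            star (vfc φ S s) * vfc φ S' s * ((walsh S x : ℂ) * (walsh S' x : ℂ) * (walsh U x : ℂ)) / 2 ^ N := by
          refine Finset.sum_congr rfl fun x _ => ?_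
          rw [Finset.sum_div]
          refine Finset.sum_congr rfl fun s _ => ?_
          rw [Finset.sum_mul_sum, Finset.sum_mul, Finset.sum_div]
          refine Finset.sum_congr rfl fun S _ => ?_
          rw [Finset.sum_mul, Finset.sum_div]
          refine Finset.sum_congr rfl fun S' _ => ?_
          ring
      _ = ∑ s, ∑ S : Finset (Fin N), ∑ S' : Finset (Fin N), star (vfc φ S s) * vfc φ S' s *
            ((∑ x : Fin N → Bool, (walsh S x : ℂ) * (walsh S' x : ℂ) * (walsh U x : ℂ)) / 2 ^ N) := by
          rw [Finset.sum_comm]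
          refine Finset.sum_congr rfl fun s _ => ?_
          rw [Finset.sum_comm]
          refine Finset.sum_congr rfl fun S _ => ?_
          rw [Finset.sum_comm]
          refine Finset.sum_congr rfl fun S' _ => ?_
          rw [Finset.sum_div, Finset.mul_sum]
          refine Finset.sum_congr rfl fun x _ => ?_
          ring
      _ = ∑ s, ∑ S : Finset (Fin N), star (vfc φ S s) * vfc φ (S ∆ U) s := by
          refine Finset.sum_congr rfl fun s _ => Finset.sum_congr rfl fun S _ => ?_
          simp_rw [sum_walsh_three]
          simp_rw [show ∀ S' : Finset (Fin N), (S ∆ S' = U) = (S' = S ∆ U) from fun S' => by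
            apply propext; constructor
            · rintro rfl; rw [← symmDiff_assoc, symmDiff_self, bot_symmDiff]
            · rintro rfl; rw [← symmDiff_assoc, symmDiff_self, bot_symmDiff]]
          simp_rw [ite_div, zero_div, mul_ite, mul_zero]
          rw [Finset.sum_ite_eq' Finset.univ (S ∆ U)]
          simp [h2]
      _ = ∑ S : Finset (Fin N), ∑ s, star (vfc φ S s) * vfc φ (S ∆ U) s := Finset.sum_comm
  rw [← Complex.ofReal_re (((∑ x : Fin N → Bool, (∑ s, ‖φ x s‖ ^ 2) * walsh U x) / 2 ^ N : ℝ)), key]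

/-- For a state of level `≤ T` and `|U| = 2T`, only `S ⊆ U` with `|S| = T` contribute to
`Σ_S ⟨v_S, v_{S∆U}⟩`, and there `S ∆ U = U ∖ S`. [cite: BealsEtAl2001, Lemma 4.1] -/
theorem sum_dotProduct_symmDiff_eq_top {T : ℕ} {v : Finset (Fin N) → Fin N × Bool × W → ℂ}
    (hv : ∀ S : Finset (Fin N), T < S.card → v S = 0) {U : Finset (Fin N)} (hU : U.card = 2 * T) :
    ∑ S : Finset (Fin N), star (v S) ⬝ᵥ v (S ∆ U) =
      ∑ S ∈ Finset.univ.filter (fun S : Finset (Fin N) => S.card = T ∧ S ⊆ U), star (v S) ⬝ᵥ v (U \ S) := by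
  rw [← Finset.sum_subset (Finset.subset_univ (Finset.univ.filter (fun S : Finset (Fin N) => S.card = T ∧ S ⊆ U)))]
  · refine Finset.sum_congr rfl fun S hS => ?_
    rw [Finset.mem_filter] at hS
    have : S ∆ U = U \ S := by
      ext j
      simp only [Finset.mem_symmDiff, Finset.mem_sdiff]
      constructor
      · rintro (⟨hjS, hjU⟩ | ⟨hjU, hjS⟩)
        · exact absurd (hS.2.2 hjS) hjU
        · exact ⟨hjU, hjS⟩
      · rintro ⟨hjU, hjS⟩; exact Or.inr ⟨hjU, hjS⟩
    rw [this]
  · intro S _ hS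
    rw [Finset.mem_filter, not_and] at hS
    have hS' := hS (Finset.mem_univ S)
    -- either `|S| > T`, or `|S ∆ U| > T`
    by_cases h1 : T < S.card
    · rw [hv S h1, star_zero, zero_dotProduct]
    · have h2 : T < (S ∆ U).card := by
        by_contra h2
        push Not at h1 h2
        -- `|U \\ S| ≤ |S ∆ U| ≤ T` and `|U| = 2T` force `|S ∩ U| ≥ T ≥ |S|`, so `S ⊆ U`, `|S| = T`
        have hsub : U \ S ⊆ S ∆ U := fun j hj => by
          rw [Finset.mem_sdiff] at hj
          exact Finset.mem_symmDiff.mpr (Or.inr ⟨hj.1, hj.2⟩)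
        have h3 : (U \ S).card ≤ T := (Finset.card_le_card hsub).trans h2
        have h4 : (U \ S).card + (U ∩ S).card = U.card := Finset.card_sdiff_add_card_inter U S
        have h5 : (U ∩ S).card ≤ S.card := Finset.card_le_card Finset.inter_subset_right
        have h6 : (U ∩ S).card = S.card := by omega
        have h7 : U ∩ S = S := Finset.eq_of_subset_of_card_le Finset.inter_subset_right h6.ge
        have hSU : S ⊆ U := by rw [← h7]; exact Finset.inter_subset_left
        exact hS' ⟨by omega, hSU⟩
      rw [hv _ h2, dotProduct_zero]

/-- **`B(U)` is the Walsh coefficient of the acceptance probability**: for `|U| = 2T`,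
`p̂(U) = Σ_{R ⊆ U, |R| = T} ⟨Π v_R, Π v_{U∖R}⟩` (real part form; the sum is real). [cite: EscuderoGutierrez2023, §4.2] -/
theorem cubeFourierCoeff_acceptProb_eq_topCoeff (A : QQueryAlg N) {U : Finset (Fin N)}
    (hU : U.card = 2 * A.queries) :
    cubeFourierCoeff (fun x => A.acceptProb x) U = (topCoeff A U).re := by
  classical
  -- the accept-projected state
  set φ : (Fin N → Bool) → Fin N × Bool × A.W → ℂ := fun x s => if s ∈ A.accept then A.finalState x s else 0
    with hφ
  have hvφ : ∀ S, vfc φ S = accVfc A S := by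
    intro S
    funext s
    simp only [vfc, accVfc, hφ]
    split_ifs with hs
    · rfl
    · simp
  have hlev : ∀ S : Finset (Fin N), A.queries < S.card → vfc φ S = 0 := by
    intro S hS
    rw [hvφ]
    funext s
    simp only [accVfc, Pi.zero_apply]
    rw [level_finalState A S hS]
    simp
  have hp : ∀ x, A.acceptProb x = ∑ s, ‖φ x s‖ ^ 2 := by
    intro x
    unfold QQueryAlg.acceptProb
    rw [Finset.sum_filter]
    refine Finset.sum_congr rfl fun s _ => ?_
    simp only [hφ]
    split_ifs <;> simp
  unfold cubeFourierCoeff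
  simp_rw [hp]
  rw [fourierCoeff_norm_sq φ U, sum_dotProduct_symmDiff_eq_top hlev hU]
  simp_rw [hvφ]
  rfl

/-- The Walsh coefficient of the acceptance probability at a `2T`-set, squared, is `|B(U)|²`. [folklore] -/
theorem cubeFourierCoeff_acceptProb_sq (A : QQueryAlg N) {U : Finset (Fin N)} (hU : U.card = 2 * A.queries) :
    cubeFourierCoeff (fun x => A.acceptProb x) U ^ 2 = ‖topCoeff A U‖ ^ 2 := by
  -- `B(U)` is real: it equals its own conjugate (swap `R ↔ U \ R`)
  have hreal : (topCoeff A U).im = 0 := by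
    have hsymm : star (topCoeff A U) = topCoeff A U := by
      unfold topCoeff
      rw [star_sum]
      refine Finset.sum_nbij' (fun R => U \ R) (fun R => U \ R) ?_ ?_ ?_ ?_ ?_
      · intro R hR
        simp only [Finset.mem_filter, Finset.mem_univ, true_and] at hR ⊢
        refine ⟨?_, Finset.sdiff_subset⟩
        rw [Finset.card_sdiff_of_subset hR.2, hU, hR.1]; omega
      · intro R hR
        simp only [Finset.mem_filter, Finset.mem_univ, true_and] at hR ⊢
        refine ⟨?_, Finset.sdiff_subset⟩
        rw [Finset.card_sdiff_of_subset hR.2, hU, hR.1]; omega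
      · intro R hR
        simp only [Finset.mem_filter, Finset.mem_univ, true_and] at hR
        exact Finset.sdiff_sdiff_eq_self hR.2
      · intro R hR
        simp only [Finset.mem_filter, Finset.mem_univ, true_and] at hR
        exact Finset.sdiff_sdiff_eq_self hR.2
      · intro R hR
        simp only [Finset.mem_filter, Finset.mem_univ, true_and] at hR
        rw [Finset.sdiff_sdiff_eq_self hR.2]
        -- `conj ⟨a, b⟩ = ⟨b, a⟩`
        simp only [dotProduct, Pi.star_apply, star_sum, star_mul, star_star, mul_comm]
    have := congrArg Complex.im hsymm
    rw [Complex.star_def, Complex.conj_im] at this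
    linarith
  rw [cubeFourierCoeff_acceptProb_eq_topCoeff A hU, Complex.sq_norm, Complex.normSq_apply, hreal]
  ring

/-- **The homogeneous rung on `Q_T` (Escudero Gutiérrez, Cor. 1.7), tree vocabulary.**  Let `A` be a `T`-query
quantum algorithm (`T ≥ 1`) and `p` a real polynomial agreeing with its acceptance probability on the cube.  If
`p` is TOP-HOMOGENEOUS of order `T` — the Laplacian eigen-equation `Σᵢ (p(x) − p(x ⊕ eᵢ)) = 4T (p(x) − E p)` of the
route's `HomogeneousPBAA(T)`, i.e. the centred part of `p` lives on Walsh level `2T` — then some variable has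
`Inf_i[p] ≥ 4·Var[p]²` (tree influence `= 4 ×` O'Donnell's; DEGREE-FREE constant).  So the body of the route's
refuted degree-free rung `HomogeneousPBAA` (false on `K_T`: address family, `Inf = 16 Var²/T`) HOLDS on the
subclass `Q_T` of genuine quantum acceptance probabilities. [cite: EscuderoGutierrez2023, Cor 1.7] -/
theorem queryHomogeneousRung (A : QQueryAlg N) (hT : 1 ≤ A.queries) (p : MvPolynomial (Fin N) ℝ)
    (hp : ∀ x, evalBool p x = A.acceptProb x)
    (hhom : ∀ x : Fin N → Bool, ∑ i : Fin N, (evalBool p x - evalBool p (Function.update x i (!x i))) =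
      4 * (A.queries : ℝ) * (evalBool p x - boolAvg (evalBool p))) :
    ∃ i : Fin N, 4 * boolVariance p ^ 2 ≤ influence i p := by
  have hfun : evalBool p = fun x => A.acceptProb x := funext hp
  -- the variance is the top-level weight
  have hvar : boolVariance p =
      ∑ U ∈ Finset.univ.filter (fun U : Finset (Fin N) => U.card = 2 * A.queries), ‖topCoeff A U‖ ^ 2 := by
    rw [boolVariance_eq_sum_sq_fourier, ← Finset.sum_subset (Finset.subset_univ
      (Finset.univ.filter (fun U : Finset (Fin N) => U.card = 2 * A.queries)))]
    · refine Finset.sum_congr rfl fun U hU => ?_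
      rw [Finset.mem_filter] at hU
      have hU0 : U ≠ ∅ := by
        intro h; rw [h, Finset.card_empty] at hU; omega
      rw [if_neg hU0, hfun, cubeFourierCoeff_acceptProb_sq A hU.2]
    · intro U _ hU
      rw [Finset.mem_filter, not_and] at hU
      by_cases hU0 : U = ∅
      · rw [if_pos hU0]
      · rw [if_neg hU0,
          TopLevelFourier.cubeFourierCoeff_eq_zero_of_laplacian A.queries p hhom hU0 (hU (Finset.mem_univ U))]
        ring
  obtain ⟨k, hk⟩ := exists_topWeight_sq_le A hT
  refine ⟨k, ?_⟩
  rw [hvar, influence_eq_sum_sq_fourier]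
  refine (mul_le_mul_of_nonneg_left hk (by norm_num)).trans (mul_le_mul_of_nonneg_left ?_ (by norm_num))
  -- `Σ_{|U| = 2T, U ∋ k} |B(U)|² ≤ Σ_{U ∋ k} p̂(U)²`
  calc ∑ U ∈ Finset.univ.filter (fun U : Finset (Fin N) => U.card = 2 * A.queries ∧ k ∈ U), ‖topCoeff A U‖ ^ 2
      = ∑ U ∈ Finset.univ.filter (fun U : Finset (Fin N) => U.card = 2 * A.queries ∧ k ∈ U),
          cubeFourierCoeff (evalBool p) U ^ 2 := by
        refine Finset.sum_congr rfl fun U hU => ?_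
        rw [Finset.mem_filter] at hU
        rw [hfun, cubeFourierCoeff_acceptProb_sq A hU.2.1]
    _ ≤ ∑ U ∈ Finset.univ.filter (fun U : Finset (Fin N) => k ∈ U), cubeFourierCoeff (evalBool p) U ^ 2 :=
        Finset.sum_le_sum_of_subset_of_nonneg
          (fun U hU => by
            rw [Finset.mem_filter] at hU ⊢
            exact ⟨hU.1, hU.2.2⟩)
          fun U _ _ => sq_nonneg _


/-- **Top-level weight versus influence, no homogeneity assumed**: for every `T`-query algorithm (`T ≥ 1`) and
every polynomial `p` agreeing with its acceptance probability on the cube, some variable has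
`Inf_i[p] ≥ 4·(W^{=2T}[p])²`, where `W^{=2T}[p] = Σ_{|U| = 2T} p̂(U)²` is the Walsh weight of `p` on the top
level `2T`. (The homogeneous rung is the case `W^{=2T} = Var`.) [cite: EscuderoGutierrez2023, Thm 1.6 (proof)] -/
theorem topWeight_sq_le_influence (A : QQueryAlg N) (hT : 1 ≤ A.queries) (p : MvPolynomial (Fin N) ℝ)
    (hp : ∀ x, evalBool p x = A.acceptProb x) :
    ∃ i : Fin N, 4 * (∑ U ∈ Finset.univ.filter (fun U : Finset (Fin N) => U.card = 2 * A.queries),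
        cubeFourierCoeff (evalBool p) U ^ 2) ^ 2 ≤ influence i p := by
  have hfun : evalBool p = fun x => A.acceptProb x := funext hp
  have hW : ∑ U ∈ Finset.univ.filter (fun U : Finset (Fin N) => U.card = 2 * A.queries),
        cubeFourierCoeff (evalBool p) U ^ 2 =
      ∑ U ∈ Finset.univ.filter (fun U : Finset (Fin N) => U.card = 2 * A.queries), ‖topCoeff A U‖ ^ 2 := by
    refine Finset.sum_congr rfl fun U hU => ?_
    rw [Finset.mem_filter] at hU
    rw [hfun, cubeFourierCoeff_acceptProb_sq A hU.2]
  obtain ⟨k, hk⟩ := exists_topWeight_sq_le A hT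
  refine ⟨k, ?_⟩
  rw [hW, influence_eq_sum_sq_fourier]
  refine (mul_le_mul_of_nonneg_left hk (by norm_num)).trans (mul_le_mul_of_nonneg_left ?_ (by norm_num))
  calc ∑ U ∈ Finset.univ.filter (fun U : Finset (Fin N) => U.card = 2 * A.queries ∧ k ∈ U), ‖topCoeff A U‖ ^ 2
      = ∑ U ∈ Finset.univ.filter (fun U : Finset (Fin N) => U.card = 2 * A.queries ∧ k ∈ U),
          cubeFourierCoeff (evalBool p) U ^ 2 := by
        refine Finset.sum_congr rfl fun U hU => ?_
        rw [Finset.mem_filter] at hU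
        rw [hfun, cubeFourierCoeff_acceptProb_sq A hU.2.1]
    _ ≤ ∑ U ∈ Finset.univ.filter (fun U : Finset (Fin N) => k ∈ U), cubeFourierCoeff (evalBool p) U ^ 2 :=
        Finset.sum_le_sum_of_subset_of_nonneg
          (fun U hU => by
            rw [Finset.mem_filter] at hU ⊢
            exact ⟨hU.1, hU.2.2⟩)
          fun U _ _ => sq_nonneg _

/-- **Every `T`-query acceptance probability HAS a polynomial representative** to which the rung applies (Beals et
al.): packaged form of `queryHomogeneousRung` quantifying over the algorithm only — if the acceptance probability of
`A` (`T ≥ 1` queries) satisfies the Laplacian eigen-equation of order `T` on the cube, then for the Beals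
polynomial `p` of `A` (any `p` with `p = acceptProb` on the cube) some variable has `Inf_i[p] ≥ 4 Var[p]²`.
[cite: EscuderoGutierrez2023, Cor 1.7] [cite: BealsEtAl2001, Lemma 4.2] -/
theorem queryHomogeneousRung' (A : QQueryAlg N) (hT : 1 ≤ A.queries)
    (hhom : ∀ x : Fin N → Bool, ∑ i : Fin N, (A.acceptProb x - A.acceptProb (Function.update x i (!x i))) =
      4 * (A.queries : ℝ) * (A.acceptProb x - boolAvg (fun y => A.acceptProb y))) :
    ∀ p : MvPolynomial (Fin N) ℝ, (∀ x, evalBool p x = A.acceptProb x) →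
      ∃ i : Fin N, 4 * boolVariance p ^ 2 ≤ influence i p := by
  intro p hp
  have hfun : evalBool p = fun x => A.acceptProb x := funext hp
  refine queryHomogeneousRung A hT p hp fun x => ?_
  rw [hfun]
  exact hhom x

end Rung

end Summit.QuantumAdvantage.QuantumAdvantage.Theorems.SosSandwich.QueryTopLevel

end
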